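import Summits.BirchSwinnertonDyer.BirchSwinnertonDyer.Theorems.SignedLowerHalvesSprungLowerDivisibilityAtThreeOffTLedgerDoor
import Summits.BirchSwinnertonDyer.BirchSwinnertonDyer.Theorems.SignedLowerHalvesSprungLowerDivisibilityAtThreeKatoSporadicLedgerKato
import Summits.BirchSwinnertonDyer.BirchSwinnertonDyer.Theorems.SignedLowerHalvesSprungLowerDivisibilityAtThreeBothColours
import HarnessLib

/-!
# Crux `SprungLowerDivisibilityAtThree` (item stmt-BirchSwinnertonDyer-19875), line `chromatic-common-zeros` (skeleton v9 =
# the x8 children by name): THE `ι`-DOOR — the off-`(T)` part of K1 (children 22569 `KatoFineLowerSporadicX8`, 22901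
# `CyclotomicLowerPosLevelX8`, the S4b-cyc conjunct of 22570) from the cokernel bound WITH ITS `ι` (F-α♮) and the
# `ι`-residue R♮ := «`k(𝔭) ≤ x(𝔭)` where the local index at the MIRROR prime `ι𝔭` is below the zeta index at `𝔭`»

Cell `bsd-ssimc` (host), LEAD seat `cruxlead-stmt-BirchSwinnertonDyer-19875` (gen 5); `--supports` stmt-BirchSwinnertonDyer-22569
`--as helper`; theorems only; closes NO item. HONEST FRAMING: a literal case split over landed ledger lemmas that RE-CUTS the
child line of 22569 / 22901 / 22570 (STUB-PLAN-stub_katoFineLowerSporadic v3 §C′ R1–R3 / §D′ Rank 2: F-α is re-typed WITH the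
involution `ι`; the ledger door `{k ≤ j}` is replaced by a door that closes in the current keying); K_spor, S4b-cyc, K1,
leaf X8 and BSD are NOT proved by anything here.

Notation at a height-one prime `𝔮` of `Λ = ℤ_p⟦T⟧` for the joint ♯/♭ Coleman–Kato package `I, Cs, Cf` (`Cs.Z = Cf.Z`) of the
line and a (`γ`-keyed) fine dual datum `Y`: `k(𝔮) = ℓ_𝔮(I.H ⧸ Cs.Z)` (zeta index), `c^•(𝔮) = ℓ_𝔮(Λ ⧸ range C•.colMap)`,
`j(𝔮) = min(c♯, c♭)(𝔮)` (local index), `m^•(𝔮) = ℓ_𝔮 Λ/(G^•)` for a Néron-normalised `G^•`, `x(𝔮) = ℓ_𝔮 Y.X` (fine mass);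
`ι𝔮 := PrimeSpectrum.comap (invol p) 𝔮` (the involution `T ↦ (1+T)⁻¹ − 1`; `ιι𝔮 = 𝔮`, `Kato2004.comap_invol_comap_invol`).
K_spor / S4b-cyc at `𝔮`: `k(𝔮) ≤ x(𝔮)`.

THE POINT. STUB-PLAN v3 (§C′ R1, R3): the print cokernel bound (joint Coleman cokernel `Λ/(T)`, Poitou–Tate, Wingberg 1989
Cor. 2.5 / Matar 2020 Thm. 1.1 `char tors X_{p^∞} = char(X₀)^ι`) reads in the tree's typed currency as
**F-α♮: `j(𝔮) ≤ x(ι𝔮)`** (NOT the same-prime F-α of skeleton v2, which is not available for the ∀-bound package at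
`ι`-moved primes, STUB-PLAN v2 §C). With the `ι` in place the natural door pairs `𝔭` with its mirror: F-α♮ AT `ι𝔭` says
`j(ι𝔭) ≤ x(𝔭)`, so
  **K at `𝔭` ⟸ `k(𝔭) ≤ j(ι𝔭)`** («zeta index at `𝔭` at most the local index at the mirror prime»),
with no Selmer input at all beyond F-α♮ (if `ι𝔭` is not a common zero, `j(ι𝔭) = 0` by the content identity `m = k + c`,
and the door degenerates to `k(𝔭) = 0`). This door CONTAINS the critic's orbit door (§C′ R2: both `𝔭`, `ι𝔭` on-branch
`k ≤ j`, chained through Thm. 7.16 at `ι𝔭`: `k(𝔭) ≤ j(𝔭) ≤ x(ι𝔭) ≤ k(ι𝔭) ≤ j(ι𝔭)`), see `zeta_le_localIndex_comap_invol_of_orbitDoor`,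
so its residue **R♮(𝔭) := `j(ι𝔭) < k(𝔭) → k(𝔭) ≤ x(𝔭)`** is contained in the critic's R_orb; at every `ι`-FIXED prime
(`(T)`, `(p)`, every positive-level cyclotomic prime — `comap_invol_eq_self_of_cyclotomic_comp_mem`, w3 g6) it is the old
door `{k ≤ j}` / residue `{j < k}` verbatim (`katoFineLowerAt_of_iotaDoor_of_comap_invol_eq`), so child 22901's content is
unchanged by the re-cut.
* §0 `X_mem_comap_invol_iff`: `T ∈ ι𝔮 ⟺ T ∈ 𝔮` (`ι T = −T(1+T)⁻¹`).
* §1 `katoFineLowerAt_of_iotaDoor` (one prime, package level): (F-α♮ at `𝔮` towards `𝔭`, asked only if `𝔮` is a common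
  zero) ∧ `k(𝔭) ≤ j(𝔮)` ⟹ `k(𝔭) ≤ x(𝔭)`; `zeta_le_localIndex_comap_invol_of_orbitDoor`: the critic's chain lands in this door.
* §2 `katoFineLowerOffT_of_iotaDoor (hFα♮) (hres♮)`: `k ≤ x` at EVERY height-one `𝔭 ∌ p, T` that is a common zero, over the
  line's joint binders (the shared off-`(T)` form), from the two ∀-statements F-α♮ and R♮ — the signatures registered as the
  child stubs `stub_cokerBoundIotaOffT` / `stub_katoFineLowerResidueIotaOffT` of skeleton v3 on 22569 / 22901 / 22570.
* (sibling file `…IotaDoorStubs`) `stubs_offT_of_iotaDoor (hFα♮) (hres♮) : K_spor ∧ S4b-cyc` — both v8 signatures VERBATIM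
  (the conclusion of `stubs_offT_of_ledgerDoor`, p651820, unchanged), so the child compositions swap one name.

References: [Kato2004Asterisque] Conj. 12.10 (p. 224), Thm. 12.5/12.6 (p. 222), §17.13 (17.13.1) (p. 280); [Sprung2012] §7.1
Props. 7.3/7.6, Def. 6.1, Thm. 7.14 (3), Thm. 7.16 (p. 1504), Prop. 7.19, Main Conj. 7.21 (p. 1505); [KuriharaPollack2007]
Prop. 1.2, Problem 3.2; [LeiSujatha2021] §3 (SES-KP), (PT); [Wingberg1989] Cor. 2.5; [Matar2020] Thm. 1.1; [Greenberg1989] §0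
(the involution); [MazurTateTeitelbaum1986Invent] Ch. I §17; tree: `…OffTLedgerDoor` (p651820), `…KatoSporadicLedger` (p648387),
`…KatoSporadicLedgerKato` (p649616), `…CyclotomicPosLevelLedgerDoor` (p651345), `…CyclotomicPosLevelLedgerOrbit`,
`Cruxes/SprungLowerDivisibilityAtThree/STUB-PLAN-stub_katoFineLowerSporadic.md` v3 §C′/§D′.
-/

set_option linter.dupNamespace false
set_option autoImplicit false

noncomputable section

open scoped Classical NumberField MatrixGroups ModularForm Polynomial

open NumberField IsDedekindDomain CongruenceSubgroup WeierstrassCurve Field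
  Literature.NumberTheory.EllipticCurves Literature.NumberTheory.EllipticCurves.ModularForms
  Literature.NumberTheory.EllipticCurves.ZpExtension Literature.NumberTheory.EllipticCurves.Sprung2017
  Literature.NumberTheory.EllipticCurves.Sprung2012 Literature.NumberTheory.EllipticCurves.Rank1Residual
  Literature.NumberTheory.EllipticCurves.IwasawaAlgebra Literature.NumberTheory.EllipticCurves.Kato2004
  Literature.NumberTheory.EllipticCurves.Module
  Summit.BirchSwinnertonDyer.BirchSwinnertonDyer.Theorems
  Summit.BirchSwinnertonDyer.BirchSwinnertonDyer.Theorems.SmallImageSignedMuDefect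

namespace Summit.BirchSwinnertonDyer.BirchSwinnertonDyer.Theorems.ChromaticCommonZeros

/-! ### §0 `T ∈ ι𝔮 ⟺ T ∈ 𝔮` -/

/-- **The augmentation variable is `ι`-invariant on primes:** for every prime `𝔮` of `Λ`, `T ∈ ι𝔮 ⟺ T ∈ 𝔮`, because
`ι(T)·(1+T) = −T` with `1 + T ∈ Λˣ`. (So the side condition `T ∉ 𝔭` of the off-`(T)` stubs transports to the mirror prime.)
[cite: MazurTateTeitelbaum1986Invent, Ch. I §17] -/
theorem X_mem_comap_invol_iff {p : ℕ} [Fact p.Prime] (𝔮 : PrimeSpectrum (IwasawaAlgebra p)) :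
    (PowerSeries.X : IwasawaAlgebra p) ∈ (PrimeSpectrum.comap (invol p).toRingHom 𝔮).asIdeal ↔
      (PowerSeries.X : IwasawaAlgebra p) ∈ 𝔮.asIdeal := by
  rw [PrimeSpectrum.comap_asIdeal, Ideal.mem_comap]
  change invol p PowerSeries.X ∈ 𝔮.asIdeal ↔ (PowerSeries.X : IwasawaAlgebra p) ∈ 𝔮.asIdeal
  have hu : IsUnit (1 + PowerSeries.X : IwasawaAlgebra p) := by
    rw [PowerSeries.isUnit_iff_constantCoeff, map_add, map_one, PowerSeries.constantCoeff_X, add_zero]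
    exact isUnit_one
  rw [← Ideal.mul_unit_mem_iff_mem 𝔮.asIdeal hu, invol_X_mul_one_add_X, neg_mem_iff]

/-- `T ∉ 𝔮 ⟹ T ∉ ι𝔮` (the direction the doors use). [cite: MazurTateTeitelbaum1986Invent, Ch. I §17] -/
theorem X_not_mem_comap_invol {p : ℕ} [Fact p.Prime] (𝔮 : PrimeSpectrum (IwasawaAlgebra p))
    (hT : (PowerSeries.X : IwasawaAlgebra p) ∉ 𝔮.asIdeal) :
    (PowerSeries.X : IwasawaAlgebra p) ∉ (PrimeSpectrum.comap (invol p).toRingHom 𝔮).asIdeal :=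
  fun h => hT ((X_mem_comap_invol_iff 𝔮).mp h)

/-! ### §1 The `ι`-door at one prime (package level) -/

section Package

variable (W : WeierstrassCurve ℚ) [W.IsElliptic] (p : ℕ) [Fact p.Prime]
  [ContinuousSMul ℤ_[p] (W.tateModule p)] [Module.Free ℤ_[p] (W.tateModule p)]
  [Module.Finite ℤ_[p] (W.tateModule p)]
  {N : ℕ} {f : CuspForm (Gamma0 N) 2} {ϖ : ℚ} {κ : ZpExtension ℚ p} {γ : absoluteGaloisGroup ℚ}
  {E : Type} [Field E] [Algebra ℚ E] {ι : AlgebraicClosure ℚ →ₐ[ℚ] AlgebraicClosure E} {ap : ℤ}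
  {g : absoluteGaloisGroup E} {c : ℕ → localPoints W E} {I : IwasawaH1Data W p κ γ}

/-- **If some non-vanishing normalised colour misses `𝔮`, the local index at `𝔮` vanishes:** `G' ∉ 𝔮` with
`ι G' = C(ϖ)·ι L^{•'}`, `L^{•'} ≠ 0`, `E[p]` irreducible, height-one `𝔮` ⟹ `min(c♯, c♭)(𝔮) = 0` — from the content identity
`m^{•'} = k + c^{•'}` (`lengthAt_quotient_span_eq_zeta_add_range`, p648387) with `m^{•'}(𝔮) = 0`.
[cite: Sprung2012, Def. 6.1, Thm. 7.14 (3) (p. 1504)] [cite: Kato2004Asterisque, Thm. 12.6 (p. 222)] -/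
theorem localIndex_eq_zero_of_normalised_not_mem
    (Cs : SharpFlatColemanKatoData W p f ϖ κ γ ι ap g c Chroma.sharp I)
    (Cf : SharpFlatColemanKatoData W p f ϖ κ γ ι ap g c Chroma.flat I)
    (hirr : W.HasIrreducibleModPGaloisRep p) {Lsharp Lflat : IwasawaAlgebra p}
    (hSP : IsSprungPair f p ap Lsharp Lflat) (hs : chromaticL Chroma.sharp Lsharp Lflat ≠ 0)
    (hfl : chromaticL Chroma.flat Lsharp Lflat ≠ 0)
    (𝔮 : PrimeSpectrum (IwasawaAlgebra p)) (h𝔮 : 𝔮.asIdeal.height = 1)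
    {col' : Chroma} {G' : IwasawaAlgebra p}
    (hG' : iwasawaToPowerSeries p G' =
      PowerSeries.C ((ϖ : ℚ) : ℚ_[p]) * iwasawaToPowerSeries p (chromaticL col' Lsharp Lflat))
    (hG'𝔮 : G' ∉ 𝔮.asIdeal) :
    min (Module.lengthAt (IwasawaAlgebra p) (IwasawaAlgebra p ⧸ LinearMap.range Cs.colMap) 𝔮)
        (Module.lengthAt (IwasawaAlgebra p) (IwasawaAlgebra p ⧸ LinearMap.range Cf.colMap) 𝔮) = 0 := by
  have hm0 : Module.lengthAt (IwasawaAlgebra p) (IwasawaAlgebra p ⧸ Ideal.span {G'}) 𝔮 = 0 :=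
    (lengthAt_quotient_span_eq_zero_iff_not_mem G' 𝔮).mpr hG'𝔮
  refine le_antisymm ?_ bot_le
  cases col' with
  | sharp =>
    have h := Cs.lengthAt_quotient_span_eq_zeta_add_range W p hirr hSP hs hG' 𝔮 h𝔮
    rw [hm0] at h
    calc min (Module.lengthAt (IwasawaAlgebra p) (IwasawaAlgebra p ⧸ LinearMap.range Cs.colMap) 𝔮)
          (Module.lengthAt (IwasawaAlgebra p) (IwasawaAlgebra p ⧸ LinearMap.range Cf.colMap) 𝔮)
        ≤ Module.lengthAt (IwasawaAlgebra p) (IwasawaAlgebra p ⧸ LinearMap.range Cs.colMap) 𝔮 := min_le_left _ _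
      _ ≤ Module.lengthAt (IwasawaAlgebra p) (I.H ⧸ Cs.Z) 𝔮 +
          Module.lengthAt (IwasawaAlgebra p) (IwasawaAlgebra p ⧸ LinearMap.range Cs.colMap) 𝔮 := le_add_self
      _ = 0 := h.symm
  | flat =>
    have h := Cf.lengthAt_quotient_span_eq_zeta_add_range W p hirr hSP hfl hG' 𝔮 h𝔮
    rw [hm0] at h
    calc min (Module.lengthAt (IwasawaAlgebra p) (IwasawaAlgebra p ⧸ LinearMap.range Cs.colMap) 𝔮)
          (Module.lengthAt (IwasawaAlgebra p) (IwasawaAlgebra p ⧸ LinearMap.range Cf.colMap) 𝔮)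
        ≤ Module.lengthAt (IwasawaAlgebra p) (IwasawaAlgebra p ⧸ LinearMap.range Cf.colMap) 𝔮 := min_le_right _ _
      _ ≤ Module.lengthAt (IwasawaAlgebra p) (I.H ⧸ Cf.Z) 𝔮 +
          Module.lengthAt (IwasawaAlgebra p) (IwasawaAlgebra p ⧸ LinearMap.range Cf.colMap) 𝔮 := le_add_self
      _ = 0 := h.symm

/-- **THE `ι`-DOOR AT ONE PRIME.** Joint ♯/♭ package `Cs, Cf`, both colours non-zero, `E[p]` irreducible; a fine dual datum `Y`;
primes `𝔭` (the target) and `𝔮` (height one; in the line `𝔮 = ι𝔭`). IF (hFα) «whenever every normalised colour vanishes at `𝔮`,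
the local index at `𝔮` is fine mass at `𝔭`: `j(𝔮) ≤ x(𝔭)`» (= F-α♮ at `𝔮 = ι𝔭`, since `ιι𝔭 = 𝔭`) and (hdoor) «`k(𝔭) ≤ j(𝔮)`»,
THEN Kato's fine inequality `k(𝔭) ≤ x(𝔭)` holds at `𝔭`. If `𝔮` is not a common zero, `j(𝔮) = 0`
(`localIndex_eq_zero_of_normalised_not_mem`) and the door says `k(𝔭) = 0`. Pure transitivity over the content identity.
[cite: Kato2004Asterisque, Conj. 12.10 (p. 224), (17.13.1) (p. 280)] [cite: Sprung2012, §7.1, Props. 7.3/7.6, Thm. 7.14 (3)]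
[cite: Wingberg1989, Cor. 2.5] [cite: Matar2020, Thm. 1.1] -/
theorem katoFineLowerAt_of_iotaDoor
    (Cs : SharpFlatColemanKatoData W p f ϖ κ γ ι ap g c Chroma.sharp I)
    (Cf : SharpFlatColemanKatoData W p f ϖ κ γ ι ap g c Chroma.flat I)
    (hirr : W.HasIrreducibleModPGaloisRep p) {Lsharp Lflat : IwasawaAlgebra p}
    (hSP : IsSprungPair f p ap Lsharp Lflat) (hs : chromaticL Chroma.sharp Lsharp Lflat ≠ 0)
    (hfl : chromaticL Chroma.flat Lsharp Lflat ≠ 0)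
    (Y : W.FineSelmerDualData κ γ) (𝔭 𝔮 : PrimeSpectrum (IwasawaAlgebra p)) (h𝔮 : 𝔮.asIdeal.height = 1)
    (hFα : (∀ (col' : Chroma) (G' : IwasawaAlgebra p),
        iwasawaToPowerSeries p G' =
          PowerSeries.C ((ϖ : ℚ) : ℚ_[p]) * iwasawaToPowerSeries p (chromaticL col' Lsharp Lflat) →
        G' ∈ 𝔮.asIdeal) →
      min (Module.lengthAt (IwasawaAlgebra p) (IwasawaAlgebra p ⧸ LinearMap.range Cs.colMap) 𝔮)
          (Module.lengthAt (IwasawaAlgebra p) (IwasawaAlgebra p ⧸ LinearMap.range Cf.colMap) 𝔮) ≤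
        Module.lengthAt (IwasawaAlgebra p) Y.X 𝔭)
    (hdoor : Module.lengthAt (IwasawaAlgebra p) (I.H ⧸ Cs.Z) 𝔭 ≤
      min (Module.lengthAt (IwasawaAlgebra p) (IwasawaAlgebra p ⧸ LinearMap.range Cs.colMap) 𝔮)
          (Module.lengthAt (IwasawaAlgebra p) (IwasawaAlgebra p ⧸ LinearMap.range Cf.colMap) 𝔮)) :
    Module.lengthAt (IwasawaAlgebra p) (I.H ⧸ Cs.Z) 𝔭 ≤ Module.lengthAt (IwasawaAlgebra p) Y.X 𝔭 := by
  by_cases hcommon : ∀ (col' : Chroma) (G' : IwasawaAlgebra p),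
      iwasawaToPowerSeries p G' =
        PowerSeries.C ((ϖ : ℚ) : ℚ_[p]) * iwasawaToPowerSeries p (chromaticL col' Lsharp Lflat) →
      G' ∈ 𝔮.asIdeal
  · exact hdoor.trans (hFα hcommon)
  · push Not at hcommon
    obtain ⟨col', G', hG', hG'𝔮⟩ := hcommon
    rw [localIndex_eq_zero_of_normalised_not_mem W p Cs Cf hirr hSP hs hfl 𝔮 h𝔮 hG' hG'𝔮] at hdoor
    exact hdoor.trans bot_le

/-- **The critic's ORBIT DOOR lands in the `ι`-door** (STUB-PLAN v3 §C′ R2, displayed as pure chaining): with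
`𝔮 = ι𝔭`, IF `k(𝔭) ≤ j(𝔭)` (on-branch at `𝔭`), `j(𝔭) ≤ x(𝔮)` (F-α♮ at `𝔭`), `x(𝔮) ≤ k(𝔮)` (Kato's bound = Thm. 7.16's
output at `𝔮`, `fine_le_zeta_of_pow_mul_mem_charIdeal`) and `k(𝔮) ≤ j(𝔮)` (on-branch at `𝔮`), THEN `k(𝔭) ≤ j(𝔮)` — the
hypothesis `hdoor` of `katoFineLowerAt_of_iotaDoor`. Hence the `ι`-residue R♮ `{j(ι𝔭) < k(𝔭)}` is contained in the critic's
R_orb `{j(𝔭) < k(𝔭) ∨ j(ι𝔭) < k(ι𝔭)}`. Stated over abstract lengths (`ℕ∞`). [cite: Kato2004Asterisque, Conj. 12.10 (p. 224), Thm. 12.5 (p. 222)]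
[cite: Sprung2012, Thm. 7.16 (p. 1504)] -/
theorem zeta_le_localIndex_comap_invol_of_orbitDoor {k j k' j' x' : ℕ∞}
    (hbranch : k ≤ j) (hFα : j ≤ x') (hKato : x' ≤ k') (hbranch' : k' ≤ j') : k ≤ j' :=
  ((hbranch.trans hFα).trans hKato).trans hbranch'

/-- **At an `ι`-FIXED prime the `ι`-door is the ledger door** (`ι𝔭 = 𝔭`: `(T)`, `(p)`, every positive-level cyclotomic prime —
`comap_invol_eq_self_of_cyclotomic_comp_mem`, w3 g6): hypotheses F-α♮ at `𝔭` and `k(𝔭) ≤ j(𝔭)` give `k(𝔭) ≤ x(𝔭)`, i.e.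
`katoFineLowerAt_of_cokerBound_of_zeta_le_localIndex` (p648952) verbatim. So the re-cut changes nothing for child 22901.
[cite: Kato2004Asterisque, Conj. 12.10 (p. 224)] [cite: Sprung2012, Main Conj. 7.21 (p. 1505)] -/
theorem katoFineLowerAt_of_iotaDoor_of_comap_invol_eq
    (Cs : SharpFlatColemanKatoData W p f ϖ κ γ ι ap g c Chroma.sharp I)
    (Cf : SharpFlatColemanKatoData W p f ϖ κ γ ι ap g c Chroma.flat I)
    (hirr : W.HasIrreducibleModPGaloisRep p) {Lsharp Lflat : IwasawaAlgebra p}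
    (hSP : IsSprungPair f p ap Lsharp Lflat) (hs : chromaticL Chroma.sharp Lsharp Lflat ≠ 0)
    (hfl : chromaticL Chroma.flat Lsharp Lflat ≠ 0)
    (Y : W.FineSelmerDualData κ γ) (𝔭 : PrimeSpectrum (IwasawaAlgebra p)) (h𝔭 : 𝔭.asIdeal.height = 1)
    (hfix : PrimeSpectrum.comap (invol p).toRingHom 𝔭 = 𝔭)
    (hFα : (∀ (col' : Chroma) (G' : IwasawaAlgebra p),
        iwasawaToPowerSeries p G' =
          PowerSeries.C ((ϖ : ℚ) : ℚ_[p]) * iwasawaToPowerSeries p (chromaticL col' Lsharp Lflat) →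
        G' ∈ 𝔭.asIdeal) →
      min (Module.lengthAt (IwasawaAlgebra p) (IwasawaAlgebra p ⧸ LinearMap.range Cs.colMap) 𝔭)
          (Module.lengthAt (IwasawaAlgebra p) (IwasawaAlgebra p ⧸ LinearMap.range Cf.colMap) 𝔭) ≤
        Module.lengthAt (IwasawaAlgebra p) Y.X (PrimeSpectrum.comap (invol p).toRingHom 𝔭))
    (hkj : Module.lengthAt (IwasawaAlgebra p) (I.H ⧸ Cs.Z) 𝔭 ≤
      min (Module.lengthAt (IwasawaAlgebra p) (IwasawaAlgebra p ⧸ LinearMap.range Cs.colMap) 𝔭)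
          (Module.lengthAt (IwasawaAlgebra p) (IwasawaAlgebra p ⧸ LinearMap.range Cf.colMap) 𝔭)) :
    Module.lengthAt (IwasawaAlgebra p) (I.H ⧸ Cs.Z) 𝔭 ≤ Module.lengthAt (IwasawaAlgebra p) Y.X 𝔭 := by
  rw [hfix] at hFα
  exact katoFineLowerAt_of_iotaDoor W p Cs Cf hirr hSP hs hfl Y 𝔭 𝔭 h𝔭 hFα hkj

end Package

/-! ### §2 The off-`(T)` composition: `k ≤ x` at every height-one common zero `𝔭 ∌ p, T` from F-α♮ ∧ R♮ -/

/-- **`k ≤ x` OFF `(T)` FROM F-α♮ ∧ R♮** (the shared composition of the child skeletons v3 on 22569 / 22901 / 22570). Over the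
line's joint colour-free binders (X8 pair, cyclotomic/Honda setting, newform and Sprung pair, `I, Cs, Cf` with `Cs.Z = Cf.Z`,
a fine dual datum `Y`) and a height-one prime `𝔭` with `p ∉ 𝔭`, `T ∉ 𝔭` at which every normalised colour vanishes:
* (hFα) **F-α♮, the cokernel bound WITH ITS `ι`**: `min_• ℓ_𝔭(Λ ⧸ range C•.colMap) ≤ ℓ_{ι𝔭} Y.X` — the typed reading of the
  print composite «joint Coleman cokernel `Λ/(T)` (Kurihara–Pollack Prop. 1.2 / Lei–Sujatha (SES-KP); in tree: injective
  p653370, `T·Λ² ⊆ range` mod (IND) p655403) + Poitou–Tate (Kato (17.13.1)) + `char tors X_{p^∞} = char(X₀)^ι` (Wingberg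
  Cor. 2.5 / Matar Thm. 1.1)» for the `γ`-keyed `Y` (STUB-PLAN v3 §C′ R1/R3); displayed, = child stub
  `stub_cokerBoundIotaOffT` VERBATIM;
* (hres) **R♮, the `ι`-residue**: «`ℓ_𝔭(I.H ⧸ Cs.Z) ≤ ℓ_𝔭 Y.X` whenever `min_• ℓ_{ι𝔭}(Λ ⧸ range C•.colMap) < ℓ_𝔭(I.H ⧸ Cs.Z)`»
  (the local index at the mirror prime is below the zeta index) = child stub `stub_katoFineLowerResidueIotaOffT` with its
  fact binders discharged; research (signed main conjecture ⊆ there; OPEN in print at `(3, a₃ = ±3)`);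
THEN `ℓ_𝔭(I.H ⧸ Cs.Z) ≤ ℓ_𝔭 Y.X`. Proof: at `ι𝔭` (height one, `p, T ∉ ι𝔭`) either the residue hypothesis holds, or
`k(𝔭) ≤ j(ι𝔭)` and `katoFineLowerAt_of_iotaDoor` applies with F-α♮ AT `ι𝔭` (`ιι𝔭 = 𝔭`). Nothing is discharged.
[cite: Kato2004Asterisque, Conj. 12.10 (p. 224), (17.13.1) (p. 280)] [cite: Sprung2012, §7.1, Props. 7.3/7.6, Prop. 7.19, Main Conj. 7.21 (p. 1505)]
[cite: KuriharaPollack2007, Prop. 1.2] [cite: LeiSujatha2021, §3] [cite: Wingberg1989, Cor. 2.5] [cite: Matar2020, Thm. 1.1] -/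
theorem katoFineLowerOffT_of_iotaDoor
    (hFα : ∀ (W : WeierstrassCurve ℚ) [W.IsElliptic] [W.IsGloballyMinimal] (p : ℕ) [Fact p.Prime]
      [ContinuousSMul ℤ_[p] (W.tateModule p)] [Module.Free ℤ_[p] (W.tateModule p)]
      [Module.Finite ℤ_[p] (W.tateModule p)],
      ClassX8 W p → ∀ (κ : ZpExtension ℚ p) (γ : Field.absoluteGaloisGroup ℚ),
      κ.IsCyclotomic → κ.IsTopGenerator γ → IsCyclotomicVariable p γ →
    ∀ (v : HeightOneSpectrum (𝓞 ℚ)), (p : 𝓞 ℚ) ∈ v.asIdeal →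
    ∀ (g : Field.absoluteGaloisGroup (v.adicCompletion ℚ)),
      κ.IsTopGenerator (resGalOfEmb (closureEmb (K := ℚ) (v.adicCompletion ℚ)) g) →
    ∀ (cneg : localPoints W (v.adicCompletion ℚ)) (c : ℕ → localPoints W (v.adicCompletion ℚ)),
      IsHondaSystem κ (closureEmb (K := ℚ) (v.adicCompletion ℚ)) W (W.frobeniusTrace p) g cneg c →
    ∀ (N : ℕ) (_ : NeZero N) (f : CuspForm (Gamma0 N) 2) (ϖ : ℚ) (Lsharp Lflat : IwasawaAlgebra p),
      IsNewformOf W f → (ϖ : ℝ) * W.realPeriodRat = plusPeriod f →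
      IsSprungPair f p (W.frobeniusTrace p) Lsharp Lflat →
    ∀ (I : Kato2004.IwasawaH1Data W p κ γ)
      (Cs : SharpFlatColemanKatoData W p f ϖ κ γ (closureEmb (K := ℚ) (v.adicCompletion ℚ))
        (W.frobeniusTrace p) g c Chroma.sharp I)
      (Cf : SharpFlatColemanKatoData W p f ϖ κ γ (closureEmb (K := ℚ) (v.adicCompletion ℚ))
        (W.frobeniusTrace p) g c Chroma.flat I),
      Cs.Z = Cf.Z →
    ∀ (Y : W.FineSelmerDualData κ γ) (𝔭 : PrimeSpectrum (IwasawaAlgebra p)), 𝔭.asIdeal.height = 1 →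
      (p : IwasawaAlgebra p) ∉ 𝔭.asIdeal → (PowerSeries.X : IwasawaAlgebra p) ∉ 𝔭.asIdeal →
      (∀ (col' : Chroma) (G' : IwasawaAlgebra p),
        iwasawaToPowerSeries p G' =
          PowerSeries.C (ϖ : ℚ_[p]) * iwasawaToPowerSeries p (chromaticL col' Lsharp Lflat) →
        G' ∈ 𝔭.asIdeal) →
      min (Module.lengthAt (IwasawaAlgebra p) (IwasawaAlgebra p ⧸ LinearMap.range Cs.colMap) 𝔭)
          (Module.lengthAt (IwasawaAlgebra p) (IwasawaAlgebra p ⧸ LinearMap.range Cf.colMap) 𝔭) ≤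
        Module.lengthAt (IwasawaAlgebra p) Y.X (PrimeSpectrum.comap (invol p).toRingHom 𝔭))
    (hres : ∀ (W : WeierstrassCurve ℚ) [W.IsElliptic] [W.IsGloballyMinimal] (p : ℕ) [Fact p.Prime]
      [ContinuousSMul ℤ_[p] (W.tateModule p)] [Module.Free ℤ_[p] (W.tateModule p)]
      [Module.Finite ℤ_[p] (W.tateModule p)],
      ClassX8 W p → ∀ (κ : ZpExtension ℚ p) (γ : Field.absoluteGaloisGroup ℚ),
      κ.IsCyclotomic → κ.IsTopGenerator γ → IsCyclotomicVariable p γ →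
    ∀ (v : HeightOneSpectrum (𝓞 ℚ)), (p : 𝓞 ℚ) ∈ v.asIdeal →
    ∀ (g : Field.absoluteGaloisGroup (v.adicCompletion ℚ)),
      κ.IsTopGenerator (resGalOfEmb (closureEmb (K := ℚ) (v.adicCompletion ℚ)) g) →
    ∀ (cneg : localPoints W (v.adicCompletion ℚ)) (c : ℕ → localPoints W (v.adicCompletion ℚ)),
      IsHondaSystem κ (closureEmb (K := ℚ) (v.adicCompletion ℚ)) W (W.frobeniusTrace p) g cneg c →
    ∀ (N : ℕ) (_ : NeZero N) (f : CuspForm (Gamma0 N) 2) (ϖ : ℚ) (Lsharp Lflat : IwasawaAlgebra p),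
      IsNewformOf W f → (ϖ : ℝ) * W.realPeriodRat = plusPeriod f →
      IsSprungPair f p (W.frobeniusTrace p) Lsharp Lflat →
    ∀ (I : Kato2004.IwasawaH1Data W p κ γ)
      (Cs : SharpFlatColemanKatoData W p f ϖ κ γ (closureEmb (K := ℚ) (v.adicCompletion ℚ))
        (W.frobeniusTrace p) g c Chroma.sharp I)
      (Cf : SharpFlatColemanKatoData W p f ϖ κ γ (closureEmb (K := ℚ) (v.adicCompletion ℚ))
        (W.frobeniusTrace p) g c Chroma.flat I),
      Cs.Z = Cf.Z →
    ∀ (Y : W.FineSelmerDualData κ γ) (𝔭 : PrimeSpectrum (IwasawaAlgebra p)), 𝔭.asIdeal.height = 1 →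
      (p : IwasawaAlgebra p) ∉ 𝔭.asIdeal → (PowerSeries.X : IwasawaAlgebra p) ∉ 𝔭.asIdeal →
      (∀ (col' : Chroma) (G' : IwasawaAlgebra p),
        iwasawaToPowerSeries p G' =
          PowerSeries.C (ϖ : ℚ_[p]) * iwasawaToPowerSeries p (chromaticL col' Lsharp Lflat) →
        G' ∈ 𝔭.asIdeal) →
      min (Module.lengthAt (IwasawaAlgebra p) (IwasawaAlgebra p ⧸ LinearMap.range Cs.colMap)
            (PrimeSpectrum.comap (invol p).toRingHom 𝔭))
          (Module.lengthAt (IwasawaAlgebra p) (IwasawaAlgebra p ⧸ LinearMap.range Cf.colMap)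
            (PrimeSpectrum.comap (invol p).toRingHom 𝔭)) <
          Module.lengthAt (IwasawaAlgebra p) (I.H ⧸ Cs.Z) 𝔭 →
      Module.lengthAt (IwasawaAlgebra p) (I.H ⧸ Cs.Z) 𝔭 ≤ Module.lengthAt (IwasawaAlgebra p) Y.X 𝔭) :
    ∀ (W : WeierstrassCurve ℚ) [W.IsElliptic] [W.IsGloballyMinimal] (p : ℕ) [Fact p.Prime]
      [ContinuousSMul ℤ_[p] (W.tateModule p)] [Module.Free ℤ_[p] (W.tateModule p)]
      [Module.Finite ℤ_[p] (W.tateModule p)],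
      ClassX8 W p → ∀ (κ : ZpExtension ℚ p) (γ : Field.absoluteGaloisGroup ℚ),
      κ.IsCyclotomic → κ.IsTopGenerator γ → IsCyclotomicVariable p γ →
    ∀ (v : HeightOneSpectrum (𝓞 ℚ)), (p : 𝓞 ℚ) ∈ v.asIdeal →
    ∀ (g : Field.absoluteGaloisGroup (v.adicCompletion ℚ)),
      κ.IsTopGenerator (resGalOfEmb (closureEmb (K := ℚ) (v.adicCompletion ℚ)) g) →
    ∀ (cneg : localPoints W (v.adicCompletion ℚ)) (c : ℕ → localPoints W (v.adicCompletion ℚ)),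
      IsHondaSystem κ (closureEmb (K := ℚ) (v.adicCompletion ℚ)) W (W.frobeniusTrace p) g cneg c →
    ∀ (N : ℕ) (_ : NeZero N) (f : CuspForm (Gamma0 N) 2) (ϖ : ℚ) (Lsharp Lflat : IwasawaAlgebra p),
      IsNewformOf W f → (ϖ : ℝ) * W.realPeriodRat = plusPeriod f →
      IsSprungPair f p (W.frobeniusTrace p) Lsharp Lflat →
    ∀ (I : Kato2004.IwasawaH1Data W p κ γ)
      (Cs : SharpFlatColemanKatoData W p f ϖ κ γ (closureEmb (K := ℚ) (v.adicCompletion ℚ))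
        (W.frobeniusTrace p) g c Chroma.sharp I)
      (Cf : SharpFlatColemanKatoData W p f ϖ κ γ (closureEmb (K := ℚ) (v.adicCompletion ℚ))
        (W.frobeniusTrace p) g c Chroma.flat I),
      Cs.Z = Cf.Z →
    ∀ (Y : W.FineSelmerDualData κ γ) (𝔭 : PrimeSpectrum (IwasawaAlgebra p)), 𝔭.asIdeal.height = 1 →
      (p : IwasawaAlgebra p) ∉ 𝔭.asIdeal → (PowerSeries.X : IwasawaAlgebra p) ∉ 𝔭.asIdeal →
      (∀ (col' : Chroma) (G' : IwasawaAlgebra p),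
        iwasawaToPowerSeries p G' =
          PowerSeries.C (ϖ : ℚ_[p]) * iwasawaToPowerSeries p (chromaticL col' Lsharp Lflat) →
        G' ∈ 𝔭.asIdeal) →
      Module.lengthAt (IwasawaAlgebra p) (I.H ⧸ Cs.Z) 𝔭 ≤ Module.lengthAt (IwasawaAlgebra p) Y.X 𝔭 := by
  intro W _ _ p _ _ _ _ hX κ γ hκ hγ hcv v hv g hg cneg c hH N hN f ϖ Lsharp Lflat hf hϖ hSP I Cs Cf hZ Y 𝔭 h𝔭
    hp𝔭 hT hcommon
  haveI : NeZero N := hN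
  -- the mirror prime `𝔮 = ι𝔭`: height one, `p ∉ 𝔮`, `T ∉ 𝔮`
  obtain ⟨h𝔮, hp𝔮⟩ := comap_invol_heightOne_not_mem 𝔭 h𝔭 hp𝔭
  have hT𝔮 := X_not_mem_comap_invol 𝔭 hT
  by_cases hlt :
      min (Module.lengthAt (IwasawaAlgebra p) (IwasawaAlgebra p ⧸ LinearMap.range Cs.colMap)
            (PrimeSpectrum.comap (invol p).toRingHom 𝔭))
          (Module.lengthAt (IwasawaAlgebra p) (IwasawaAlgebra p ⧸ LinearMap.range Cf.colMap)
            (PrimeSpectrum.comap (invol p).toRingHom 𝔭)) <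
        Module.lengthAt (IwasawaAlgebra p) (I.H ⧸ Cs.Z) 𝔭
  · -- the `ι`-residue
    exact hres W p hX κ γ hκ hγ hcv v hv g hg cneg c hH N hN f ϖ Lsharp Lflat hf hϖ hSP I Cs Cf hZ Y 𝔭 h𝔭 hp𝔭 hT
      hcommon hlt
  · -- the `ι`-door: `k(𝔭) ≤ j(ι𝔭) ≤ x(ιι𝔭) = x(𝔭)`
    have hs : chromaticL Chroma.sharp Lsharp Lflat ≠ 0 :=
      ChromaticBothColours.ClassX8.chromaticL_ne_zero W p hX f Lsharp Lflat hf hSP Chroma.sharp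
    have hfl : chromaticL Chroma.flat Lsharp Lflat ≠ 0 :=
      ChromaticBothColours.ClassX8.chromaticL_ne_zero W p hX f Lsharp Lflat hf hSP Chroma.flat
    refine katoFineLowerAt_of_iotaDoor W p Cs Cf (ClassX8.irr' W p hX) hSP hs hfl Y 𝔭
      (PrimeSpectrum.comap (invol p).toRingHom 𝔭) h𝔮 ?_ (not_lt.mp hlt)
    intro hcommon𝔮
    have h := hFα W p hX κ γ hκ hγ hcv v hv g hg cneg c hH N hN f ϖ Lsharp Lflat hf hϖ hSP I Cs Cf hZ Y
      (PrimeSpectrum.comap (invol p).toRingHom 𝔭) h𝔮 hp𝔮 hT𝔮 hcommon𝔮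
    rwa [Kato2004.comap_invol_comap_invol] at h

end Summit.BirchSwinnertonDyer.BirchSwinnertonDyer.Theorems.ChromaticCommonZeros

end
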